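import Literature.MathematicalPhysics.QuantumFieldTheory.Balaban1983to89.Beta.AveragedAFCarrierJsBal
import Literature.MathematicalPhysics.QuantumFieldTheory.Balaban1983to89.Beta.AveragedAFCarrierAllScales
import Literature.MathematicalPhysics.QuantumFieldTheory.Balaban1983to89.Beta.HessKerDressedCauchy
import Literature.MathematicalPhysics.QuantumFieldTheory.Balaban1983to89.Beta.HessKerDressedLimit

/-!
# Beta / AveragedAFCarrierJsBalCauchy — the located [III] list over the wall's closed term IN CAUCHY CURRENCY
# (β sub-cell, [III]-side CO-LEAD unit `b2b-balaban-strat-b14` gen 25; trigger (t1)/(t1′) of MISSING-B14 §9.37 (e): a NEW END form over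
# `JsBalOf` landed — asym1-g12 `Beta.HessKerDressedCauchy` v1 p193269 «road A2 for the wall's dressed family: the wall ⟺ the exact
# identification of the telescoped limit, modulo (CONV-C-Cauchy)», with its road-B sockets `endpointExistence_JsBalOf_of_allScalesConst_cont`)

HONEST FRAMING (page 1 of everything the β sub-cell writes): discharging `BetaPertH` makes Bałaban's UV stability UNCONDITIONAL — a
real constructive-QFT result; it is NOT the continuum limit and NOT the Clay problem.  THIS MODULE is CLASS-LEVEL BOOKKEEPING: it
COMPOSES BY APPLICATION two landed files — asym1's UPSTREAM side of the wall over Bałaban's completed family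
(`HessKerDressedCauchy.d1Drift_JsBalOf_iff_lim_eq` / `d1Drift_JsBalOf_of_limKernel_eq`: (CONV-C-Cauchy) + the identification ⟹
`hD : D1Drift Lc (JsBalOf …) N μ ν`) and this lineage's DOWNSTREAM side (`AveragedAFCarrierJsBal` §1: `hD` ⟹ the whole located [III]
list; `AveragedAFCarrierAllScales` §1: the all-scales × constant road ⟹ END + the [III] list) — and asserts nothing printed by Bałaban;
every statement is [folklore] bookkeeping over the cell's hypothesis carriers.  EVERY load-bearing β-binder below — the all-scales bound
`hall` (or the six (CONV-C-Cauchy) data binders that supply it), the identification `hlim`/`hident`, the certified list `hlist`, (D4)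
`RemainderConst`, (C) `BetaContH` — is a HYPOTHESIS; for the family `JsBalOf …` the identification `hlim : CauchyRate.lim β⁰ = stepBal N Lc`
IS THE WALL in Cauchy currency (asym1: «road A2's second half — the identification NOBODY has proved — is the whole residue of the
wall once the rate data are in») — nothing here proves it, and nothing here could; road-(1) verdict unchanged (PRECISELY WALLED at
END-STATEMENT grade; nothing of (M2⁺)/`BetaPertH` discharged); value = census precision (MISSING-B14 §9 Table 9.1 read over the
closed term in BOTH currencies), NOT summit progress.

ABSOLUTE RULE (cell charter, verbatim): "No internally-minted statement may enter as a cited fact. Every hypothesis is either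
kernel-proved in this package or a verbatim quotation of a PUBLISHED theorem with page reference. The manuscript(s) under audit are
NOT citable for their own disputed steps — they are the thing under adjudication; programme-internal (2001/route/tribunal) claims
are never citable."

## Why this leaf exists (and why it is a separate leaf)

`AveragedAFCarrierJsBal` v1 (gen 24, p193080) reads the whole located [III] list off ONE binder `hD : D1Drift Lc (JsBalOf …) N μ ν` —
the wall's literal (WALL v2.18).  asym1-g12's `HessKerDressedCauchy` v1 (p193269) then landed the UPSTREAM algebra for the same family:
under an all-scales bound of the family's one-loop numbers `β⁰_j := secondMoment (TbalOf Lc (JsBalOf …) j) μ ν` with a rate `θ < 1`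
(supplied, with an EXPLICIT `κ`, from six pointwise/all-scales data binders on the UNDRESSED primitives `KInvStep Lc j`,
`(JsBal0Of … j).S`, `W j` — (CONV-C-Cauchy), located, NOT in print), the wall `D1Drift Lc (JsBalOf …) N μ ν` is EQUIVALENT to the single
real identity `CauchyRate.lim β⁰ = stepBal N Lc` (`d1Drift_JsBalOf_iff_lim_eq`), and road B (positivity / `EndpointExistence` from a
certified finite list + one numeric gap, asym2's `RemainderConstAllScales` sockets) needs no identification at all.  asym1's header
records the relation «strat-b14's `AveragedAFCarrierJsBal` is DOWNSTREAM … the two compose by application».  This leaf IS that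
composition, kernel-checked, so that a (T-def) brick / the T⁴ cell / MISSING-B14 Table 9.1 read the [III] list for Bałaban's completed
family off ONE theorem BY NAME in either currency:

* §1 ROAD A2 ON THE [III] SIDE (the identification ⟹ the wall ⟹ the [III] list): `wallEND_of_allScales_lim_eq_JsBalOf_cont_allProfiles`
  — binders = the family's own binders + an all-scales bound `hall : AllScalesSeq β⁰ κ θ` (ANY supplier), `0 ≤ θ < 1`, **the identification
  `hlim : CauchyRate.lim β⁰ = stepBal N Lc`** + EXACTLY the END binders of `AveragedAFCarrierJsBal.wallEND_of_D1Drift_JsBalOf_cont_allProfiles`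
  minus `hD` ⟹ its conclusion (`β′ := stepBal N Lc + 2A + r`); `flowIneq_…` ((2.6)–(2.9) at `r ≤ stepBal N Lc`, NO (C)), `t4FlowInputs_…`,
  `betaAvgAFH_…` (the minimal carrier `∃ A, BetaAvgAFH (stepBal N Lc − r) (2A) γ β`); and the POINTWISE forms
  `wallEND_of_pointwise_limKernel_eq_JsBalOf_cont_allProfiles` / `betaAvgAFH_of_pointwise_limKernel_eq_JsBalOf` with the six (CONV-C-Cauchy)
  data binders written out and the identification read on the telescoped limit kernel,
  `hident : secondMoment (limKernelOf (TbalOf Lc (JsBalOf …))) μ ν = stepBal N Lc` (asym1's `d1Drift_JsBalOf_of_limKernel_eq`).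
* §2 ROAD B ON THE [III] SIDE OVER THE CLOSED TERM (no identification, no wall): `allScalesConst_END_JsBalOf_allProfiles_cont` — binders =
  `hβ0 : Sβ.β0 j = β⁰_j`, `hall` (ANY supplier), the one-sided certified list `hlist : ∀ k ≤ k₁, m ≤ Sβ.β0 k` (cap lanes), (D4)
  `RemainderConst Sβ γ₀ r`, the ONE numeric condition `r < m − κθ^{k₁}`, (C) + run-side ⟹ `EndpointExistence ∧` the [III] list with the (U)-DERIVED
  `β′ := Sβ.β0 0 + κ + r` (`AveragedAFCarrierAllScales.allScalesConst_END_allProfiles_cont` at `hall.congr hβ0` — the [III] twin of asym1's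
  `endpointExistence_JsBalOf_of_allScalesConst_cont`); `allScalesConst_flowIneq_JsBalOf_allProfiles_cont` (`r ≤ …`, NO (C)),
  `allScalesConst_t4FlowInputs_JsBalOf_cont`, `betaAvgAFH_of_allScalesConst_JsBalOf` (the carrier `BetaAvgAFH (m − κθ^{k₁} − r) 0 γ₀ β`, defect
  ZERO); and the JOINED form `pointwise_allScalesConst_END_JsBalOf_allProfiles_cont` with the six data binders and asym1's EXPLICIT
  `κ = betaPrime510 4 (lipW …) (R·Lc)` written out (the [III] twin of asym1's `thm2Printed_JsBalOf_of_pointwise_cont`).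

A SEPARATE LEAF, not `AveragedAFCarrierJsBal` v1.1: v1 is cross-read and COUNTS (lit1 C-lit1g24-3) and stays byte-identical; the two
new imports (`AveragedAFCarrierAllScales`, `HessKerDressedCauchy`) bring asym2's `RemainderConstAllScales` / asym1's `HessKerSchurCauchy`
closures, which §1–§3 of v1 do not need; no import cycle (neither new import has an `AveragedAFCarrierJsBal*` module in its closure).
EXPONENT-AGNOSTIC: the PROVISIONAL UNITS numerals (P6′) live inside `BalabanStepJetsSucc.Sstep` and are never unfolded here — if (P6′)
re-weights `Sstep` body-only, nothing in this file changes.  One-line proofs (application); theorems only.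

THE TWO CURRENCIES SIDE BY SIDE (MISSING-B14 §9 Table 9.1, both rows already present; what is new is that both are read over the
closed term `JsBalOf …`): road A2 gives the (AF-avg) row `∃ A, BetaAvgAFH (stepBal N Lc − r) (2A) γ β` (slope = the AF slope minus the
remainder constant, defect `2A`, `A = κ/(1−θ)` on the (⇐) direction) from `hall` + `θ < 1` + THE IDENTIFICATION; road B gives the
(all-scales) row `BetaAvgAFH (m − κθ^{k₁} − r) 0 γ₀ β` (slope = certified floor minus tail allowance minus remainder, defect `0`) from
`hall` + the certified list, NO `θ`-range, NO identification.  Neither is discharged for Bałaban's family here.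

NON-VACUITY.  For an ABSTRACT sequence the road-B binder list is jointly inhabited with positive slope (asym2's oscillating split,
`AveragedAFCarrierAllScales` §5 `allScalesConst_carrier_osc`); for an abstract `Js` the road-A2 list is inhabited (lead `WallWitness`).
For the closed family `JsBalOf …` the inhabitation of `hall`'s suppliers and of `hlim` is EXACTLY the open work of the sub-cell
((CONV-C-Cauchy): supplier rows an2 (P4) `SecondOrderResponse`, (P6′), an5; the identification: road (1)) — no witness is offered or
possible here, by design; the theorems are implications.  READING CLAUSE (W-KKT-2) as in `AveragedAFCarrierJsBal` / `HessKerDressedCauchy`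
(headers): the identification of `β⁰_j` with the printed (1.22) coefficient of [Balaban1987RG1] p. 264 is the sub-cell's READING,
delivered with (T-def) — NOT asserted by any theorem here.

VERSIONS.  v1 (gen 25, p193429): §1–§2, imports `AveragedAFCarrierJsBal` + `AveragedAFCarrierAllScales` + `HessKerDressedCauchy`.
v1.1 (same gen, APPEND-ONLY + ONE import `…Beta.HessKerDressedLimit`; every v1 declaration byte-identical; theorems only): + §3 LIMIT
CURRENCY — trigger (t1) again: asym1-g13's `HessKerDressedLimit` v1 (p194057) makes road A2's identification binder EXPLICIT — the
telescoped limit kernel of the wall's family IS `hessKer (axDressK Lc K∞) (axVertexOfK K∞ Lc S∞) W∞` at named or constructed limit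
primitives (`limMKerOf (KInvStep Lc)`, `limStOf (j ↦ (JsBal0Of … j).S)`, `limTabOf W`) — so the [III] list is read off the EXPLICIT
identity `secondMoment (hessKer (axDressK Lc K∞) (axVertexOfK K∞ Lc S∞) W∞) μ ν = stepBal N Lc`: `wallEND_of_pointwise_lim_eq_JsBalOf_cont_allProfiles`
/ `betaAvgAFH_of_pointwise_lim_eq_JsBalOf` (ANY named limits `(K∞, S∞, W∞)` with `j`-uniform bounds + rate data, via
`HessKerDressedLimit.d1Drift_JsBalOf_of_lim_eq`) and `wallEND_of_cauchy_eq_JsBalOf_cont_allProfiles` / `betaAvgAFH_of_cauchy_eq_JsBalOf`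
(EXACTLY the six (CONV-C-Cauchy) binders, identification at the CONSTRUCTED limits, via `d1Drift_JsBalOf_of_cauchy_eq`).  Discharges nothing:
the explicit identity is the wall (road A2's second half / road (1)), NOT proved anywhere.

Source located (consumer locators, quoted verbatim in `B14FlowStep` / `AveragedAFCarrier` / `AveragedAFCarrierAllScales`, nothing newly
quoted): [Balaban1987RG1, Thm 2 p.259, Thm 3 p.264, (2.12)–(2.14) p.268]; [Balaban1988Convergent, (2.5)–(2.9) pp.255–256, (2.28) p.259,
(2.46) p.263].
-/

noncomputable section

namespace Literature.MathematicalPhysics.QuantumFieldTheory.Balaban1983to89.Beta.AveragedAFCarrierJsBalCauchy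

open Finset
open Literature.MathematicalPhysics.QuantumFieldTheory.Balaban1983to89
open FlowStep FlowStepRuns DagBinding B14DeltaBeta
open Literature.MathematicalPhysics.QuantumFieldTheory.Balaban1983to89.Beta.RemainderChain (RemainderConst)
open Literature.MathematicalPhysics.QuantumFieldTheory.Balaban1983to89.Beta.RemainderConstAllScales (AllScalesSeq)
open Literature.MathematicalPhysics.QuantumFieldTheory.Balaban1983to89.Beta.RateCertificate (CauchyRate)
open Literature.MathematicalPhysics.QuantumFieldTheory.Balaban1983to89.Beta.LimitRate (limKernelOf)
open Literature.MathematicalPhysics.QuantumFieldTheory.Balaban1983to89.Beta.OneStepResolventKernel (Fib LocStencil JetData)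
open Literature.MathematicalPhysics.QuantumFieldTheory.Balaban1983to89.Beta.OneStepKernelFamily (KInvStep TbalOf D1Drift)
open Literature.MathematicalPhysics.QuantumFieldTheory.Balaban1983to89.Beta.AxialDressing (cAx cN' axDressK axVertexOfK)
open Literature.MathematicalPhysics.QuantumFieldTheory.Balaban1983to89.Beta.BalabanStepJetsSucc (JsBal0Of JsBalOf)
open Literature.MathematicalPhysics.QuantumFieldTheory.Balaban1983to89.B12Beta (secondMoment)
open Literature.MathematicalPhysics.QuantumFieldTheory.Balaban1983to89.B12Sec2to5 (betaPrime510)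
open ExpKernelCalculus (MKer Decays VertexFamily₂ Zl hessKer)
open Literature.MathematicalPhysics.QuantumFieldTheory.Balaban1983to89.Beta.HessKerDressedLimit (limMKerOf limStOf limTabOf)
open HessKerSchur (lipW)
open ComposedRoad AveragedAFCarrier AveragedAFCarrierJsBal AveragedAFCarrierAllScales HessKerDressedCauchy

variable {β : HBeta} {Lc : ℕ} [NeZero Lc] {Λ : Type*}
  (hLc : 1 ≤ Lc) (cE cVH cΛ : ℝ)
  (W : ℕ → Fin 4 → (Fin 4 → ℤ) → Fin 4 → (Fin 4 → ℤ) → MKer 4 (Fib 3))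
  (Cw δw : ℕ → ℝ) (hδw : ∀ j, 0 < δw j) (hW : ∀ j, VertexFamily₂ (W j) Lc (Cw j) (δw j))
  {R C cK δK Cs cS δS C₂ c₂ δ₂ θ : ℝ}

/-! ## §1 Road A2 on the [III] side: an all-scales bound + THE IDENTIFICATION ⟹ the wall ⟹ the whole located [III] list -/

section RoadA2

/-- **THE WHOLE LOCATED [III] LIST OVER THE CLOSED TERM FROM THE IDENTIFICATION, ALL PROFILES** — `AveragedAFCarrierJsBal.wallEND_of_D1Drift_JsBalOf_cont_allProfiles`
with its wall binder `hD` PRODUCED by asym1's `HessKerDressedCauchy.d1Drift_iff_lim_eq` at `Js := JsBalOf …`: from an all-scales bound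
`hall : AllScalesSeq (j ↦ secondMoment (TbalOf Lc (JsBalOf …) j) μ ν) κ θ` (ANY supplier — e.g. asym1's `allScalesSeq_secondMoment_TbalOf_JsBalOf`
under (CONV-C-Cauchy)), `0 ≤ θ < 1`, **THE IDENTIFICATION `hlim : CauchyRate.lim (j ↦ secondMoment (TbalOf Lc (JsBalOf …) j) μ ν) = stepBal N Lc`**
(= the wall in Cauchy currency), `ForwardGenerated`, the split `S` with `hβ`, **(D4) `RemainderConst S γ₀ r` with `r < stepBal N Lc` STRICTLY**,
**(C) `BetaContH γ₀ β`**, `0 < γ₀` and the [III] run-side data ⟹ `EndpointExistence Cn ∧ ∃ A, ∃ γ₁ > 0, ∀ γ ≤ min γ₀ γ₁, ∀ runs in ]0,γ],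
∀ p′ ≤ p, ∀ A₀ ≥ 0: sizes ∧ HorizonFacts` with `β′ := stepBal N Lc + 2A + r`.  Discharges nothing of `BetaPertH` (`hlim` is the wall).
[cite: Balaban1987RG1, Thm 2 p.259 and Thm 3 p.264] [cite: Balaban1988Convergent, (2.5)–(2.9) pp.255–256, (2.28) p.259, (2.46) p.263] -/
theorem wallEND_of_allScales_lim_eq_JsBalOf_cont_allProfiles {μ ν : Fin 4} {κ : ℝ}
    (hall : AllScalesSeq (fun j => secondMoment (TbalOf Lc (JsBalOf hLc cE cVH cΛ W Cw δw hδw hW) j) μ ν) κ θ)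
    (hθ0 : 0 ≤ θ) (hθ1 : θ < 1) {N : ℝ}
    (hlim : CauchyRate.lim (fun j => secondMoment (TbalOf Lc (JsBalOf hLc cE cVH cΛ W Cw δw hδw hW) j) μ ν)
      = B12Normalization.stepBal N Lc)
    {Cn : B12.Construction} (hgen : ForwardGenerated Cn β) (hhalt : HaltsOutside Cn β) (hcur : CurriesHBeta Cn β)
    (S : B12Beta.OneLoopSplit β)
    (hβ : ∀ j, S.β0 j = secondMoment (TbalOf Lc (JsBalOf hLc cE cVH cΛ W Cw δw hδw hW) j) μ ν) {γ₀ r β₀ : ℝ}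
    (hγ₀ : 0 < γ₀) (hrem : RemainderConst S γ₀ r) (hr : r < B12Normalization.stepBal N Lc) (hcont : BetaContH γ₀ β)
    (hβ₀ : 0 < β₀) {L : ℕ} (hL2 : 2 ≤ L) (p : ℕ) {κ₀ : ℕ} (hκ : 6 ≤ κ₀) :
    EndpointExistence Cn ∧ ∃ A : ℝ, ∃ γ₁ : ℝ, 0 < γ₁ ∧
      ∀ γ : ℝ, 0 < γ → γ ≤ min γ₀ γ₁ → ∀ Pr : B12.RunParams, (Cn Pr).flow.InInterval γ Pr.K →
        ∀ p' : ℕ, p' ≤ p → ∀ A₀ : ℝ, 0 ≤ A₀ →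
          ∃ Rj : ℕ → ℕ, (∀ j, B14.IsRj L p' ((Cn Pr).flow.g j) (Rj j)) ∧
            HorizonFacts (Cn Pr).flow (B12Normalization.stepBal N Lc + 2 * A + r) β₀ A₀ L p' κ₀ Rj Pr.K :=
  wallEND_of_D1Drift_JsBalOf_cont_allProfiles hLc cE cVH cΛ W Cw δw hδw hW hgen hhalt hcur S hβ
    ((d1Drift_iff_lim_eq (JsBalOf hLc cE cVH cΛ W Cw δw hδw hW) hall hθ0 hθ1 N).2 hlim) hγ₀ hrem hr hcont hβ₀ hL2 p hκ

/-- **… AT `r ≤ stepBal N Lc`, NO (C): (2.6)–(2.9) FOR ALL PROFILES** from the all-scales bound + the identification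
(`AveragedAFCarrierJsBal.flowIneq_of_D1Drift_JsBalOf_allProfiles` ∘ `d1Drift_iff_lim_eq`). [cite: Balaban1988Convergent, (2.5)–(2.9) pp.255–256] -/
theorem flowIneq_of_allScales_lim_eq_JsBalOf_allProfiles {μ ν : Fin 4} {κ : ℝ}
    (hall : AllScalesSeq (fun j => secondMoment (TbalOf Lc (JsBalOf hLc cE cVH cΛ W Cw δw hδw hW) j) μ ν) κ θ)
    (hθ0 : 0 ≤ θ) (hθ1 : θ < 1) {N : ℝ}
    (hlim : CauchyRate.lim (fun j => secondMoment (TbalOf Lc (JsBalOf hLc cE cVH cΛ W Cw δw hδw hW) j) μ ν)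
      = B12Normalization.stepBal N Lc)
    {Cn : B12.Construction} (hgen : ForwardGenerated Cn β) (hhalt : HaltsOutside Cn β) (hcur : CurriesHBeta Cn β)
    (S : B12Beta.OneLoopSplit β)
    (hβ : ∀ j, S.β0 j = secondMoment (TbalOf Lc (JsBalOf hLc cE cVH cΛ W Cw δw hδw hW) j) μ ν) {γ₀ r β₀ : ℝ}
    (hγ₀ : 0 < γ₀) (hrem : RemainderConst S γ₀ r) (hr : r ≤ B12Normalization.stepBal N Lc) (hβ₀ : 0 < β₀) {L : ℕ}
    (hL2 : 2 ≤ L) (p : ℕ) :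
    ∃ A : ℝ, ∃ γ₁ : ℝ, 0 < γ₁ ∧
      ∀ γ : ℝ, 0 < γ → γ ≤ min γ₀ γ₁ → ∀ Pr : B12.RunParams, (Cn Pr).flow.InInterval γ Pr.K →
        ∀ p' : ℕ, p' ≤ p → ∀ A₀ : ℝ, 0 ≤ A₀ →
          ∃ Rj : ℕ → ℕ, (∀ j, B14.IsRj L p' ((Cn Pr).flow.g j) (Rj j)) ∧
            B14.FlowIneq26 (Cn Pr).flow.g (B12Normalization.stepBal N Lc + 2 * A + r) β₀ Pr.K ∧
            B14.FlowIneq27 (Cn Pr).flow.g (B12Normalization.stepBal N Lc + 2 * A + r) β₀ p' Pr.K ∧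
            B14.FlowIneq28 (epsK A₀ p' (Cn Pr).flow) (Cn Pr).flow.g (B12Normalization.stepBal N Lc + 2 * A + r) β₀ Pr.K ∧
            B14FlowStep.FlowIneq29 Rj (Cn Pr).flow.g L (B12Normalization.stepBal N Lc + 2 * A + r) β₀ Pr.K :=
  flowIneq_of_D1Drift_JsBalOf_allProfiles hLc cE cVH cΛ W Cw δw hδw hW hgen hhalt hcur S hβ
    ((d1Drift_iff_lim_eq (JsBalOf hLc cE cVH cΛ W Cw δw hδw hW) hall hθ0 hθ1 N).2 hlim) hγ₀ hrem hr hβ₀ hL2 p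

/-- **… AT `r ≤ stepBal N Lc`, NO (C): THE T⁴ CELL's FLOW-FACT BINDERS (MISSING-B14 §8 C19/C20)** from the all-scales bound + the
identification (`AveragedAFCarrierJsBal.t4FlowInputs_of_D1Drift_JsBalOf` ∘ `d1Drift_iff_lim_eq`). [cite: Balaban1988Convergent, (2.5)–(2.9) pp.255–256] -/
theorem t4FlowInputs_of_allScales_lim_eq_JsBalOf {μ ν : Fin 4} {κ : ℝ}
    (hall : AllScalesSeq (fun j => secondMoment (TbalOf Lc (JsBalOf hLc cE cVH cΛ W Cw δw hδw hW) j) μ ν) κ θ)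
    (hθ0 : 0 ≤ θ) (hθ1 : θ < 1) {N : ℝ}
    (hlim : CauchyRate.lim (fun j => secondMoment (TbalOf Lc (JsBalOf hLc cE cVH cΛ W Cw δw hδw hW) j) μ ν)
      = B12Normalization.stepBal N Lc)
    {Cn : B12.Construction} (hgen : ForwardGenerated Cn β) (hhalt : HaltsOutside Cn β) (hcur : CurriesHBeta Cn β)
    (S : B12Beta.OneLoopSplit β)
    (hβ : ∀ j, S.β0 j = secondMoment (TbalOf Lc (JsBalOf hLc cE cVH cΛ W Cw δw hδw hW) j) μ ν) {γ₀ r β₀ : ℝ}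
    (hγ₀ : 0 < γ₀) (hrem : RemainderConst S γ₀ r) (hr : r ≤ B12Normalization.stepBal N Lc) (hβ₀ : 0 < β₀) {L : ℕ}
    (hL2 : 2 ≤ L) {p₀ r' : ℕ} (hr' : r' ≤ p₀) :
    ∃ A : ℝ, ∃ γ₁ : ℝ, 0 < γ₁ ∧ ∀ γ : ℝ, 0 < γ → γ ≤ min γ₀ γ₁ → ∀ Pr : B12.RunParams, (Cn Pr).flow.InInterval γ Pr.K →
      B14.FlowIneq27 (Cn Pr).flow.g (B12Normalization.stepBal N Lc + 2 * A + r) β₀ p₀ Pr.K ∧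
      (∀ j, j ≤ Pr.K → 1 ≤ Real.log (((Cn Pr).flow.g j) ^ 2)⁻¹) ∧
      ∃ Rj : ℕ → ℕ, (∀ j, B14.IsRj L r' ((Cn Pr).flow.g j) (Rj j)) ∧
        B14FlowStep.FlowIneq29 Rj (Cn Pr).flow.g L (B12Normalization.stepBal N Lc + 2 * A + r) β₀ Pr.K :=
  t4FlowInputs_of_D1Drift_JsBalOf hLc cE cVH cΛ W Cw δw hδw hW hgen hhalt hcur S hβ
    ((d1Drift_iff_lim_eq (JsBalOf hLc cE cVH cΛ W Cw δw hδw hW) hall hθ0 hθ1 N).2 hlim) hγ₀ hrem hr hβ₀ hL2 hr'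

/-- **THE MINIMAL [III] CARRIER OVER THE CLOSED TERM FROM THE IDENTIFICATION**: `hall` + `0 ≤ θ < 1` + `hlim` + `hβ` + (D4)
`RemainderConst S γ r` ⟹ `∃ A, BetaAvgAFH (stepBal N Lc − r) (2A) γ β` (MISSING-B14 §9 Table 9.1, (AF-avg) row; slope `> 0` iff
`r < stepBal N Lc`) — `AveragedAFCarrierJsBal.betaAvgAFH_of_D1Drift_JsBalOf` ∘ `d1Drift_iff_lim_eq`. [folklore] -/
theorem betaAvgAFH_of_allScales_lim_eq_JsBalOf {μ ν : Fin 4} {κ : ℝ}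
    (hall : AllScalesSeq (fun j => secondMoment (TbalOf Lc (JsBalOf hLc cE cVH cΛ W Cw δw hδw hW) j) μ ν) κ θ)
    (hθ0 : 0 ≤ θ) (hθ1 : θ < 1) {N : ℝ}
    (hlim : CauchyRate.lim (fun j => secondMoment (TbalOf Lc (JsBalOf hLc cE cVH cΛ W Cw δw hδw hW) j) μ ν)
      = B12Normalization.stepBal N Lc)
    (S : B12Beta.OneLoopSplit β)
    (hβ : ∀ j, S.β0 j = secondMoment (TbalOf Lc (JsBalOf hLc cE cVH cΛ W Cw δw hδw hW) j) μ ν) {γ r : ℝ}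
    (hrem : RemainderConst S γ r) :
    ∃ A : ℝ, BetaAvgAFH (B12Normalization.stepBal N Lc - r) (2 * A) γ β :=
  betaAvgAFH_of_D1Drift_JsBalOf hLc cE cVH cΛ W Cw δw hδw hW S hβ
    ((d1Drift_iff_lim_eq (JsBalOf hLc cE cVH cΛ W Cw δw hδw hW) hall hθ0 hθ1 N).2 hlim) hrem

/-- **THE WHOLE LOCATED [III] LIST OVER THE CLOSED TERM, POINTWISE FORM, ALL PROFILES** — the six (CONV-C-Cauchy) data binders on the
UNDRESSED primitives written out (`j`-uniform `Decays (KInvStep Lc j) C δK`, `LocStencil (JsBal0Of … j).S Cs δS`, `VertexFamily₂ (W j) Lc C₂ δ₂`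
and the all-scales deviations `Decays (KInvStep Lc (k+j) − KInvStep Lc k) (cK θ^k) δK`, …; `0 < R < δK`, `R/2 < δS`, `R < δ₂`; `0 ≤ θ < 1`) and
**THE IDENTIFICATION READ ON THE TELESCOPED LIMIT KERNEL `hident : secondMoment (limKernelOf (TbalOf Lc (JsBalOf …))) μ ν = stepBal N Lc`**
(asym1's `HessKerDressedCauchy.d1Drift_JsBalOf_of_limKernel_eq` produces the wall `hD`), then `AveragedAFCarrierJsBal` §1: `ForwardGenerated`,
the split `S` with `hβ`, (D4) STRICT, (C), `0 < γ₀`, run-side ⟹ the conclusion of `wallEND_of_allScales_lim_eq_JsBalOf_cont_allProfiles`.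
Discharges nothing of `BetaPertH`: the six data binders are located-unprinted hypothesis shapes and `hident` is the wall.
[cite: Balaban1987RG1, Thm 2 p.259 and Thm 3 p.264] [cite: Balaban1988Convergent, (2.5)–(2.9) pp.255–256, (2.28) p.259, (2.46) p.263] -/
theorem wallEND_of_pointwise_limKernel_eq_JsBalOf_cont_allProfiles
    (hK : ∀ j, Decays (KInvStep (d := 3) Lc j) C δK)
    (hKall : ∀ k j, Decays (KInvStep (d := 3) Lc (k + j) - KInvStep (d := 3) Lc k) (cK * θ ^ k) δK)
    (hS : ∀ j, LocStencil (JsBal0Of hLc cE cVH cΛ W Cw δw hδw hW j).S Cs δS)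
    (hSall : ∀ k j, LocStencil ((JsBal0Of hLc cE cVH cΛ W Cw δw hδw hW (k + j)).S
      - (JsBal0Of hLc cE cVH cΛ W Cw δw hδw hW k).S) (cS * θ ^ k) δS)
    (hW₂ : ∀ j, VertexFamily₂ (W j) Lc C₂ δ₂) (hW₂all : ∀ k j, VertexFamily₂ (W (k + j) - W k) Lc (c₂ * θ ^ k) δ₂)
    (hR : 0 < R) (hRK : R < δK) (hRS : R / 2 < δS) (hRW : R < δ₂) (hθ0 : 0 ≤ θ) (hθ1 : θ < 1) {μ ν : Fin 4} {N : ℝ}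
    (hident : secondMoment (limKernelOf (TbalOf Lc (JsBalOf hLc cE cVH cΛ W Cw δw hδw hW))) μ ν
      = B12Normalization.stepBal N Lc)
    {Cn : B12.Construction} (hgen : ForwardGenerated Cn β) (hhalt : HaltsOutside Cn β) (hcur : CurriesHBeta Cn β)
    (S : B12Beta.OneLoopSplit β)
    (hβ : ∀ j, S.β0 j = secondMoment (TbalOf Lc (JsBalOf hLc cE cVH cΛ W Cw δw hδw hW) j) μ ν) {γ₀ r β₀ : ℝ}
    (hγ₀ : 0 < γ₀) (hrem : RemainderConst S γ₀ r) (hr : r < B12Normalization.stepBal N Lc) (hcont : BetaContH γ₀ β)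
    (hβ₀ : 0 < β₀) {L : ℕ} (hL2 : 2 ≤ L) (p : ℕ) {κ₀ : ℕ} (hκ : 6 ≤ κ₀) :
    EndpointExistence Cn ∧ ∃ A : ℝ, ∃ γ₁ : ℝ, 0 < γ₁ ∧
      ∀ γ : ℝ, 0 < γ → γ ≤ min γ₀ γ₁ → ∀ Pr : B12.RunParams, (Cn Pr).flow.InInterval γ Pr.K →
        ∀ p' : ℕ, p' ≤ p → ∀ A₀ : ℝ, 0 ≤ A₀ →
          ∃ Rj : ℕ → ℕ, (∀ j, B14.IsRj L p' ((Cn Pr).flow.g j) (Rj j)) ∧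
            HorizonFacts (Cn Pr).flow (B12Normalization.stepBal N Lc + 2 * A + r) β₀ A₀ L p' κ₀ Rj Pr.K :=
  wallEND_of_D1Drift_JsBalOf_cont_allProfiles hLc cE cVH cΛ W Cw δw hδw hW hgen hhalt hcur S hβ
    (d1Drift_JsBalOf_of_limKernel_eq hLc cE cVH cΛ W Cw δw hδw hW hK hKall hS hSall hW₂ hW₂all hR hRK hRS hRW hθ0 hθ1 μ ν
      hident) hγ₀ hrem hr hcont hβ₀ hL2 p hκ

/-- **THE MINIMAL [III] CARRIER, POINTWISE FORM**: the six (CONV-C-Cauchy) data binders + `0 ≤ θ < 1` + `hident` (on the telescoped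
limit kernel) + `hβ` + (D4) ⟹ `∃ A, BetaAvgAFH (stepBal N Lc − r) (2A) γ β` — `AveragedAFCarrierJsBal.betaAvgAFH_of_D1Drift_JsBalOf` ∘
asym1's `d1Drift_JsBalOf_of_limKernel_eq`. [folklore] -/
theorem betaAvgAFH_of_pointwise_limKernel_eq_JsBalOf
    (hK : ∀ j, Decays (KInvStep (d := 3) Lc j) C δK)
    (hKall : ∀ k j, Decays (KInvStep (d := 3) Lc (k + j) - KInvStep (d := 3) Lc k) (cK * θ ^ k) δK)
    (hS : ∀ j, LocStencil (JsBal0Of hLc cE cVH cΛ W Cw δw hδw hW j).S Cs δS)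
    (hSall : ∀ k j, LocStencil ((JsBal0Of hLc cE cVH cΛ W Cw δw hδw hW (k + j)).S
      - (JsBal0Of hLc cE cVH cΛ W Cw δw hδw hW k).S) (cS * θ ^ k) δS)
    (hW₂ : ∀ j, VertexFamily₂ (W j) Lc C₂ δ₂) (hW₂all : ∀ k j, VertexFamily₂ (W (k + j) - W k) Lc (c₂ * θ ^ k) δ₂)
    (hR : 0 < R) (hRK : R < δK) (hRS : R / 2 < δS) (hRW : R < δ₂) (hθ0 : 0 ≤ θ) (hθ1 : θ < 1) {μ ν : Fin 4} {N : ℝ}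
    (hident : secondMoment (limKernelOf (TbalOf Lc (JsBalOf hLc cE cVH cΛ W Cw δw hδw hW))) μ ν
      = B12Normalization.stepBal N Lc)
    (S : B12Beta.OneLoopSplit β)
    (hβ : ∀ j, S.β0 j = secondMoment (TbalOf Lc (JsBalOf hLc cE cVH cΛ W Cw δw hδw hW) j) μ ν) {γ r : ℝ}
    (hrem : RemainderConst S γ r) :
    ∃ A : ℝ, BetaAvgAFH (B12Normalization.stepBal N Lc - r) (2 * A) γ β :=
  betaAvgAFH_of_D1Drift_JsBalOf hLc cE cVH cΛ W Cw δw hδw hW S hβ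
    (d1Drift_JsBalOf_of_limKernel_eq hLc cE cVH cΛ W Cw δw hδw hW hK hKall hS hSall hW₂ hW₂all hR hRK hRS hRW hθ0 hθ1 μ ν
      hident) hrem

end RoadA2

/-! ## §2 Road B on the [III] side over the closed term: all-scales × certified list × constant remainder — NO identification, NO wall -/

section RoadB

/-- **END + THE [III] LIST OVER THE CLOSED TERM ON THE ALL-SCALES × CONSTANT ROAD, ALL PROFILES, (U) DERIVED** — the [III] twin of
asym1's `HessKerDressedCauchy.endpointExistence_JsBalOf_of_allScalesConst_cont` (= `AveragedAFCarrierAllScales.allScalesConst_END_allProfiles_cont`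
at `hall.congr hβ0`): binders `hβ0 : Sβ.β0 j = secondMoment (TbalOf Lc (JsBalOf …) j) μ ν`, an all-scales bound `hall` of those numbers (ANY
supplier; NO `θ`-range, NO limit), the one-sided certified list `hlist : ∀ k ≤ k₁, m ≤ Sβ.β0 k` (cap lanes), (D4) `RemainderConst Sβ γ₀ r`, the
ONE numeric condition `r < m − κθ^{k₁}`, (C), run-side, `0 < β₀`, `L ≥ 2`, `p`, `κ₀ ≥ 6` ⟹ `EndpointExistence Cn ∧ ∃ γ₁ > 0, …, sizes ∧
HorizonFacts` with the DERIVED `β′ := Sβ.β0 0 + κ + r` — no `hup`, no `hβ′`, NO identification, NO wall.  Discharges nothing of `BetaPertH`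
(`hall`'s suppliers for this family and the certified list are the sub-cell's open rows).
[cite: Balaban1987RG1, Thm 2 p.259 and Thm 3 p.264] [cite: Balaban1988Convergent, (2.5)–(2.9) pp.255–256, (2.28) p.259, (2.46) p.263] -/
theorem allScalesConst_END_JsBalOf_allProfiles_cont {Cn : B12.Construction} (hgen : ForwardGenerated Cn β)
    (hhalt : HaltsOutside Cn β) (hcur : CurriesHBeta Cn β) (Sβ : B12Beta.OneLoopSplit β) {μ ν : Fin 4} {κ : ℝ}
    (hβ0 : ∀ j, Sβ.β0 j = secondMoment (TbalOf Lc (JsBalOf hLc cE cVH cΛ W Cw δw hδw hW) j) μ ν)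
    (hall : AllScalesSeq (fun j => secondMoment (TbalOf Lc (JsBalOf hLc cE cVH cΛ W Cw δw hδw hW) j) μ ν) κ θ)
    {γ₀ r m : ℝ} {k₁ : ℕ} (hγ₀ : 0 < γ₀) (hlist : ∀ k, k ≤ k₁ → m ≤ Sβ.β0 k) (hrem : RemainderConst Sβ γ₀ r)
    (hr : r < m - κ * θ ^ k₁) (hcont : BetaContH γ₀ β)
    {β₀ : ℝ} (hβ₀ : 0 < β₀) {L : ℕ} (hL2 : 2 ≤ L) (p : ℕ) {κ₀ : ℕ} (hκ : 6 ≤ κ₀) :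
    EndpointExistence Cn ∧ ∃ γ₁ : ℝ, 0 < γ₁ ∧
      ∀ γ : ℝ, 0 < γ → γ ≤ min γ₀ γ₁ → ∀ Pr : B12.RunParams, (Cn Pr).flow.InInterval γ Pr.K →
        ∀ p' : ℕ, p' ≤ p → ∀ A₀ : ℝ, 0 ≤ A₀ →
          ∃ Rj : ℕ → ℕ, (∀ j, B14.IsRj L p' ((Cn Pr).flow.g j) (Rj j)) ∧
            HorizonFacts (Cn Pr).flow (Sβ.β0 0 + κ + r) β₀ A₀ L p' κ₀ Rj Pr.K :=
  allScalesConst_END_allProfiles_cont hgen hhalt hcur Sβ hγ₀ (hall.congr hβ0) hlist hrem hr hcont hβ₀ hL2 p hκ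

/-- **(2.6)–(2.9) FOR ALL PROFILES OVER THE CLOSED TERM ON THE ALL-SCALES × CONSTANT ROAD AT SLOPE ≥ 0** (`r ≤ m − κθ^{k₁}`; NO (C), no
`hup`, no `hβ′`; `β′ := Sβ.β0 0 + κ + r`) — `AveragedAFCarrierAllScales.allScalesConst_flowIneq_allProfiles_cont` at `hall.congr hβ0`.
[cite: Balaban1988Convergent, (2.5)–(2.9) pp.255–256] -/
theorem allScalesConst_flowIneq_JsBalOf_allProfiles_cont {Cn : B12.Construction} (hgen : ForwardGenerated Cn β)
    (hhalt : HaltsOutside Cn β) (hcur : CurriesHBeta Cn β) (Sβ : B12Beta.OneLoopSplit β) {μ ν : Fin 4} {κ : ℝ}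
    (hβ0 : ∀ j, Sβ.β0 j = secondMoment (TbalOf Lc (JsBalOf hLc cE cVH cΛ W Cw δw hδw hW) j) μ ν)
    (hall : AllScalesSeq (fun j => secondMoment (TbalOf Lc (JsBalOf hLc cE cVH cΛ W Cw δw hδw hW) j) μ ν) κ θ)
    {γ₀ r m : ℝ} {k₁ : ℕ} (hγ₀ : 0 < γ₀) (hlist : ∀ k, k ≤ k₁ → m ≤ Sβ.β0 k) (hrem : RemainderConst Sβ γ₀ r)
    (hr : r ≤ m - κ * θ ^ k₁) {β₀ : ℝ} (hβ₀ : 0 < β₀) {L : ℕ} (hL2 : 2 ≤ L) (p : ℕ) :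
    ∃ γ₁ : ℝ, 0 < γ₁ ∧
      ∀ γ : ℝ, 0 < γ → γ ≤ min γ₀ γ₁ → ∀ Pr : B12.RunParams, (Cn Pr).flow.InInterval γ Pr.K →
        ∀ p' : ℕ, p' ≤ p → ∀ A₀ : ℝ, 0 ≤ A₀ →
          ∃ Rj : ℕ → ℕ, (∀ j, B14.IsRj L p' ((Cn Pr).flow.g j) (Rj j)) ∧
            B14.FlowIneq26 (Cn Pr).flow.g (Sβ.β0 0 + κ + r) β₀ Pr.K ∧ B14.FlowIneq27 (Cn Pr).flow.g (Sβ.β0 0 + κ + r) β₀ p' Pr.K ∧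
            B14.FlowIneq28 (epsK A₀ p' (Cn Pr).flow) (Cn Pr).flow.g (Sβ.β0 0 + κ + r) β₀ Pr.K ∧
            B14FlowStep.FlowIneq29 Rj (Cn Pr).flow.g L (Sβ.β0 0 + κ + r) β₀ Pr.K :=
  allScalesConst_flowIneq_allProfiles_cont hgen hhalt hcur Sβ hγ₀ (hall.congr hβ0) hlist hrem hr hβ₀ hL2 p

/-- **THE T⁴ CELL's FLOW-FACT BINDERS OVER THE CLOSED TERM ON THE ALL-SCALES × CONSTANT ROAD AT SLOPE ≥ 0** (C19/C20; NO (C), no `hup`,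
no `hβ′`) — `AveragedAFCarrierAllScales.allScalesConst_t4FlowInputs_cont` at `hall.congr hβ0`. [cite: Balaban1988Convergent, (2.5)–(2.9) pp.255–256] -/
theorem allScalesConst_t4FlowInputs_JsBalOf_cont {Cn : B12.Construction} (hgen : ForwardGenerated Cn β)
    (hhalt : HaltsOutside Cn β) (hcur : CurriesHBeta Cn β) (Sβ : B12Beta.OneLoopSplit β) {μ ν : Fin 4} {κ : ℝ}
    (hβ0 : ∀ j, Sβ.β0 j = secondMoment (TbalOf Lc (JsBalOf hLc cE cVH cΛ W Cw δw hδw hW) j) μ ν)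
    (hall : AllScalesSeq (fun j => secondMoment (TbalOf Lc (JsBalOf hLc cE cVH cΛ W Cw δw hδw hW) j) μ ν) κ θ)
    {γ₀ r m : ℝ} {k₁ : ℕ} (hγ₀ : 0 < γ₀) (hlist : ∀ k, k ≤ k₁ → m ≤ Sβ.β0 k) (hrem : RemainderConst Sβ γ₀ r)
    (hr : r ≤ m - κ * θ ^ k₁) {β₀ : ℝ} (hβ₀ : 0 < β₀) {L : ℕ} (hL2 : 2 ≤ L) {p₀ r' : ℕ} (hr' : r' ≤ p₀) :
    ∃ γ₁ : ℝ, 0 < γ₁ ∧ ∀ γ : ℝ, 0 < γ → γ ≤ min γ₀ γ₁ → ∀ Pr : B12.RunParams, (Cn Pr).flow.InInterval γ Pr.K →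
      B14.FlowIneq27 (Cn Pr).flow.g (Sβ.β0 0 + κ + r) β₀ p₀ Pr.K ∧
      (∀ j, j ≤ Pr.K → 1 ≤ Real.log (((Cn Pr).flow.g j) ^ 2)⁻¹) ∧
      ∃ Rj : ℕ → ℕ, (∀ j, B14.IsRj L r' ((Cn Pr).flow.g j) (Rj j)) ∧
        B14FlowStep.FlowIneq29 Rj (Cn Pr).flow.g L (Sβ.β0 0 + κ + r) β₀ Pr.K :=
  allScalesConst_t4FlowInputs_cont hgen hhalt hcur Sβ hγ₀ (hall.congr hβ0) hlist hrem hr hβ₀ hL2 hr'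

/-- **THE [III] CARRIER OVER THE CLOSED TERM ON THE ALL-SCALES × CONSTANT ROAD, DEFECT ZERO**: `hβ0` + `hall` + the certified list +
(D4) ⟹ `BetaAvgAFH (m − κθ^{k₁} − r) 0 γ₀ β` (MISSING-B14 §9 Table 9.1, (all-scales) row: slope = certified floor minus tail allowance minus
remainder; positive iff `r < m − κθ^{k₁}`) — `AveragedAFCarrierAllScales.betaAvgAFH_of_allScalesConst` at `hall.congr hβ0`.  No (C), no DAG,
no `θ`-range, no identification. [cite: Balaban1987RG1, (2.12)–(2.14) p.268] -/
theorem betaAvgAFH_of_allScalesConst_JsBalOf (Sβ : B12Beta.OneLoopSplit β) {μ ν : Fin 4} {κ : ℝ}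
    (hβ0 : ∀ j, Sβ.β0 j = secondMoment (TbalOf Lc (JsBalOf hLc cE cVH cΛ W Cw δw hδw hW) j) μ ν)
    (hall : AllScalesSeq (fun j => secondMoment (TbalOf Lc (JsBalOf hLc cE cVH cΛ W Cw δw hδw hW) j) μ ν) κ θ)
    {γ₀ r m : ℝ} {k₁ : ℕ} (hlist : ∀ k, k ≤ k₁ → m ≤ Sβ.β0 k) (hrem : RemainderConst Sβ γ₀ r) :
    BetaAvgAFH (m - κ * θ ^ k₁ - r) 0 γ₀ β :=
  betaAvgAFH_of_allScalesConst Sβ (hall.congr hβ0) hlist hrem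

/-- **THE JOINED ROAD-B END + [III] LIST OVER THE CLOSED TERM, POINTWISE FORM, ALL PROFILES, (U) DERIVED** — the [III] twin of asym1's
`HessKerDressedCauchy.thm2Printed_JsBalOf_of_pointwise_cont`: `hall` SUPPLIED by asym1's `allScalesSeq_secondMoment_TbalOf_JsBalOf` from the six
(CONV-C-Cauchy) data binders on the UNDRESSED primitives (`0 < R < δK`, `R/2 < δS`, `R < δ₂`; NO `θ`-range), its EXPLICIT
`κ = betaPrime510 4 (lipW …) (R·Lc)` written out in the ONE numeric condition `r < m − κθ^{k₁}` and in the derived `β′ := Sβ.β0 0 + κ + r`;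
then `allScalesConst_END_JsBalOf_allProfiles_cont`.  Discharges nothing of `BetaPertH`.
[cite: Balaban1987RG1, Thm 2 p.259 and Thm 3 p.264] [cite: Balaban1988Convergent, (2.5)–(2.9) pp.255–256, (2.28) p.259, (2.46) p.263] -/
theorem pointwise_allScalesConst_END_JsBalOf_allProfiles_cont
    (hK : ∀ j, Decays (KInvStep (d := 3) Lc j) C δK)
    (hKall : ∀ k j, Decays (KInvStep (d := 3) Lc (k + j) - KInvStep (d := 3) Lc k) (cK * θ ^ k) δK)
    (hS : ∀ j, LocStencil (JsBal0Of hLc cE cVH cΛ W Cw δw hδw hW j).S Cs δS)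
    (hSall : ∀ k j, LocStencil ((JsBal0Of hLc cE cVH cΛ W Cw δw hδw hW (k + j)).S
      - (JsBal0Of hLc cE cVH cΛ W Cw δw hδw hW k).S) (cS * θ ^ k) δS)
    (hW₂ : ∀ j, VertexFamily₂ (W j) Lc C₂ δ₂) (hW₂all : ∀ k j, VertexFamily₂ (W (k + j) - W k) Lc (c₂ * θ ^ k) δ₂)
    (hR : 0 < R) (hRK : R < δK) (hRS : R / 2 < δS) (hRW : R < δ₂) {μ ν : Fin 4}
    {Cn : B12.Construction} (hgen : ForwardGenerated Cn β) (hhalt : HaltsOutside Cn β) (hcur : CurriesHBeta Cn β)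
    (Sβ : B12Beta.OneLoopSplit β)
    (hβ0 : ∀ j, Sβ.β0 j = secondMoment (TbalOf Lc (JsBalOf hLc cE cVH cΛ W Cw δw hδw hW) j) μ ν)
    {γ₀ r m : ℝ} {k₁ : ℕ} (hγ₀ : 0 < γ₀) (hlist : ∀ k, k ≤ k₁ → m ≤ Sβ.β0 k) (hrem : RemainderConst Sβ γ₀ r)
    (hr : r < m -
        betaPrime510 4
          (lipW ((Fintype.card (Fib 3) : ℝ) * (cAx 3 Lc δK * (cAx 3 Lc δK * C)) * Zl 4 (δK - R))
            ((Fintype.card (Fib 3) : ℝ) * (cAx 3 Lc δK * (cAx 3 Lc δK * C)) * Zl 4 (δK - R))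
            ((Fintype.card (Fib 3) : ℝ) * C * Zl 4 (δK - R) *
              ((Fintype.card (Fib 3) : ℝ) ^ 2 * (cN' 3 Lc δS * Cs) * Zl 4 (δS - R / 2) ^ 2))
            ((Fintype.card (Fib 3) : ℝ) * C * Zl 4 (δK - R) *
              ((Fintype.card (Fib 3) : ℝ) ^ 2 * (cN' 3 Lc δS * Cs) * Zl 4 (δS - R / 2) ^ 2))
            ((Fintype.card (Fib 3) : ℝ) ^ 2 * C₂ * Zl 4 (δ₂ - R) ^ 2)
            ((Fintype.card (Fib 3) : ℝ) * (cAx 3 Lc δK * (cAx 3 Lc δK * cK)) * Zl 4 (δK - R))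
            ((Fintype.card (Fib 3) : ℝ) * cK * Zl 4 (δK - R) *
                ((Fintype.card (Fib 3) : ℝ) ^ 2 * (cN' 3 Lc δS * Cs) * Zl 4 (δS - R / 2) ^ 2) +
              (Fintype.card (Fib 3) : ℝ) * C * Zl 4 (δK - R) *
                ((Fintype.card (Fib 3) : ℝ) ^ 2 * (cN' 3 Lc δS * cS) * Zl 4 (δS - R / 2) ^ 2))
            ((Fintype.card (Fib 3) : ℝ) ^ 2 * c₂ * Zl 4 (δ₂ - R) ^ 2))
          (R * Lc) * θ ^ k₁)
    (hcont : BetaContH γ₀ β) {β₀ : ℝ} (hβ₀ : 0 < β₀) {L : ℕ} (hL2 : 2 ≤ L) (p : ℕ) {κ₀ : ℕ} (hκ : 6 ≤ κ₀) :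
    EndpointExistence Cn ∧ ∃ γ₁ : ℝ, 0 < γ₁ ∧
      ∀ γ : ℝ, 0 < γ → γ ≤ min γ₀ γ₁ → ∀ Pr : B12.RunParams, (Cn Pr).flow.InInterval γ Pr.K →
        ∀ p' : ℕ, p' ≤ p → ∀ A₀ : ℝ, 0 ≤ A₀ →
          ∃ Rj : ℕ → ℕ, (∀ j, B14.IsRj L p' ((Cn Pr).flow.g j) (Rj j)) ∧
            HorizonFacts (Cn Pr).flow
              (Sβ.β0 0 +
                betaPrime510 4
                  (lipW ((Fintype.card (Fib 3) : ℝ) * (cAx 3 Lc δK * (cAx 3 Lc δK * C)) * Zl 4 (δK - R))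
                    ((Fintype.card (Fib 3) : ℝ) * (cAx 3 Lc δK * (cAx 3 Lc δK * C)) * Zl 4 (δK - R))
                    ((Fintype.card (Fib 3) : ℝ) * C * Zl 4 (δK - R) *
                      ((Fintype.card (Fib 3) : ℝ) ^ 2 * (cN' 3 Lc δS * Cs) * Zl 4 (δS - R / 2) ^ 2))
                    ((Fintype.card (Fib 3) : ℝ) * C * Zl 4 (δK - R) *
                      ((Fintype.card (Fib 3) : ℝ) ^ 2 * (cN' 3 Lc δS * Cs) * Zl 4 (δS - R / 2) ^ 2))
                    ((Fintype.card (Fib 3) : ℝ) ^ 2 * C₂ * Zl 4 (δ₂ - R) ^ 2)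
                    ((Fintype.card (Fib 3) : ℝ) * (cAx 3 Lc δK * (cAx 3 Lc δK * cK)) * Zl 4 (δK - R))
                    ((Fintype.card (Fib 3) : ℝ) * cK * Zl 4 (δK - R) *
                        ((Fintype.card (Fib 3) : ℝ) ^ 2 * (cN' 3 Lc δS * Cs) * Zl 4 (δS - R / 2) ^ 2) +
                      (Fintype.card (Fib 3) : ℝ) * C * Zl 4 (δK - R) *
                        ((Fintype.card (Fib 3) : ℝ) ^ 2 * (cN' 3 Lc δS * cS) * Zl 4 (δS - R / 2) ^ 2))
                    ((Fintype.card (Fib 3) : ℝ) ^ 2 * c₂ * Zl 4 (δ₂ - R) ^ 2))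
                  (R * Lc) +
                r)
              β₀ A₀ L p' κ₀ Rj Pr.K :=
  allScalesConst_END_JsBalOf_allProfiles_cont hLc cE cVH cΛ W Cw δw hδw hW hgen hhalt hcur Sβ hβ0
    (allScalesSeq_secondMoment_TbalOf_JsBalOf hLc cE cVH cΛ W Cw δw hδw hW hK hKall hS hSall hW₂ hW₂all hR hRK hRS hRW μ ν)
    hγ₀ hlist hrem hr hcont hβ₀ hL2 p hκ

end RoadB


/-! ## §3 (v1.1) Road A2 on the [III] side in LIMIT CURRENCY: the identification read EXPLICITLY on the dressed limit primitives
(asym1-g13 `HessKerDressedLimit`: the telescoped limit kernel of the wall's family = `hessKer (axDressK Lc K∞) (axVertexOfK K∞ Lc S∞) W∞`) -/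

section LimitCurrency

variable {Kinf : MKer 4 (Fib 3)} {Sinf : Fin 4 → (Fin 4 → ℤ) → MKer 4 (Fib 3)}
  {Winf : Fin 4 → (Fin 4 → ℤ) → Fin 4 → (Fin 4 → ℤ) → MKer 4 (Fib 3)}

/-- **THE WHOLE LOCATED [III] LIST OVER THE CLOSED TERM FROM THE EXPLICIT IDENTIFICATION AT NAMED LIMIT PRIMITIVES, ALL PROFILES** —
`AveragedAFCarrierJsBal.wallEND_of_D1Drift_JsBalOf_cont_allProfiles` with its wall binder `hD` PRODUCED by asym1's
`HessKerDressedLimit.d1Drift_JsBalOf_of_lim_eq`: for ANY named limit primitives `(K∞, S∞, W∞)` with `j`-uniform bounds on the UNDRESSED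
primitives and on the limits (`Decays (KInvStep Lc j) C δK`, `Decays K∞ C δK`, `LocStencil (JsBal0Of … j).S Cs δS`, `LocStencil S∞ Cs δS`,
`VertexFamily₂ (W j) Lc C₂ δ₂`, `VertexFamily₂ W∞ Lc C₂ δ₂`) and RATE data to them (`Decays (KInvStep Lc j − K∞) (cK θ^j) δK`, …; `0 < R < δK`,
`R/2 < δS`, `R < δ₂`; `0 ≤ θ < 1`), **THE EXPLICIT IDENTIFICATION `hident : secondMoment (hessKer (axDressK Lc K∞) (axVertexOfK K∞ Lc S∞) W∞) μ ν
= stepBal N Lc`**, then `ForwardGenerated`, the split `S` with `hβ`, (D4) STRICT, (C), `0 < γ₀`, run-side ⟹ `EndpointExistence Cn ∧ ∃ A, ∃ γ₁ > 0,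
…, sizes ∧ HorizonFacts` with `β′ := stepBal N Lc + 2A + r`.  Discharges nothing of `BetaPertH` (`hident` is the wall, read explicitly).
[cite: Balaban1987RG1, Thm 2 p.259 and Thm 3 p.264] [cite: Balaban1988Convergent, (2.5)–(2.9) pp.255–256, (2.28) p.259, (2.46) p.263] -/
theorem wallEND_of_pointwise_lim_eq_JsBalOf_cont_allProfiles
    (hK : ∀ j, Decays (KInvStep (d := 3) Lc j) C δK) (hKinf : Decays Kinf C δK)
    (hKrate : ∀ j, Decays (KInvStep (d := 3) Lc j - Kinf) (cK * θ ^ j) δK)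
    (hS : ∀ j, LocStencil (JsBal0Of hLc cE cVH cΛ W Cw δw hδw hW j).S Cs δS) (hSinf : LocStencil Sinf Cs δS)
    (hSrate : ∀ j, LocStencil ((JsBal0Of hLc cE cVH cΛ W Cw δw hδw hW j).S - Sinf) (cS * θ ^ j) δS)
    (hW₂ : ∀ j, VertexFamily₂ (W j) Lc C₂ δ₂) (hWinf : VertexFamily₂ Winf Lc C₂ δ₂)
    (hWrate : ∀ j, VertexFamily₂ (W j - Winf) Lc (c₂ * θ ^ j) δ₂)
    (hR : 0 < R) (hRK : R < δK) (hRS : R / 2 < δS) (hRW : R < δ₂) (hθ0 : 0 ≤ θ) (hθ1 : θ < 1) {μ ν : Fin 4} {N : ℝ}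
    (hident : secondMoment (hessKer (axDressK Lc Kinf) (axVertexOfK Kinf Lc Sinf) Winf) μ ν = B12Normalization.stepBal N Lc)
    {Cn : B12.Construction} (hgen : ForwardGenerated Cn β) (hhalt : HaltsOutside Cn β) (hcur : CurriesHBeta Cn β)
    (S : B12Beta.OneLoopSplit β)
    (hβ : ∀ j, S.β0 j = secondMoment (TbalOf Lc (JsBalOf hLc cE cVH cΛ W Cw δw hδw hW) j) μ ν) {γ₀ r β₀ : ℝ}
    (hγ₀ : 0 < γ₀) (hrem : RemainderConst S γ₀ r) (hr : r < B12Normalization.stepBal N Lc) (hcont : BetaContH γ₀ β)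
    (hβ₀ : 0 < β₀) {L : ℕ} (hL2 : 2 ≤ L) (p : ℕ) {κ₀ : ℕ} (hκ : 6 ≤ κ₀) :
    EndpointExistence Cn ∧ ∃ A : ℝ, ∃ γ₁ : ℝ, 0 < γ₁ ∧
      ∀ γ : ℝ, 0 < γ → γ ≤ min γ₀ γ₁ → ∀ Pr : B12.RunParams, (Cn Pr).flow.InInterval γ Pr.K →
        ∀ p' : ℕ, p' ≤ p → ∀ A₀ : ℝ, 0 ≤ A₀ →
          ∃ Rj : ℕ → ℕ, (∀ j, B14.IsRj L p' ((Cn Pr).flow.g j) (Rj j)) ∧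
            HorizonFacts (Cn Pr).flow (B12Normalization.stepBal N Lc + 2 * A + r) β₀ A₀ L p' κ₀ Rj Pr.K :=
  wallEND_of_D1Drift_JsBalOf_cont_allProfiles hLc cE cVH cΛ W Cw δw hδw hW hgen hhalt hcur S hβ
    (HessKerDressedLimit.d1Drift_JsBalOf_of_lim_eq hLc cE cVH cΛ W Cw δw hδw hW hK hKinf hKrate hS hSinf hSrate hW₂ hWinf
      hWrate hR hRK hRS hRW hθ0 hθ1 μ ν hident) hγ₀ hrem hr hcont hβ₀ hL2 p hκ

/-- **THE MINIMAL [III] CARRIER FROM THE EXPLICIT IDENTIFICATION AT NAMED LIMIT PRIMITIVES**: the bounds + rate data to `(K∞, S∞, W∞)` +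
`0 ≤ θ < 1` + `hident` (explicit) + `hβ` + (D4) ⟹ `∃ A, BetaAvgAFH (stepBal N Lc − r) (2A) γ β` — `AveragedAFCarrierJsBal.betaAvgAFH_of_D1Drift_JsBalOf`
∘ asym1's `HessKerDressedLimit.d1Drift_JsBalOf_of_lim_eq`. [folklore] -/
theorem betaAvgAFH_of_pointwise_lim_eq_JsBalOf
    (hK : ∀ j, Decays (KInvStep (d := 3) Lc j) C δK) (hKinf : Decays Kinf C δK)
    (hKrate : ∀ j, Decays (KInvStep (d := 3) Lc j - Kinf) (cK * θ ^ j) δK)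
    (hS : ∀ j, LocStencil (JsBal0Of hLc cE cVH cΛ W Cw δw hδw hW j).S Cs δS) (hSinf : LocStencil Sinf Cs δS)
    (hSrate : ∀ j, LocStencil ((JsBal0Of hLc cE cVH cΛ W Cw δw hδw hW j).S - Sinf) (cS * θ ^ j) δS)
    (hW₂ : ∀ j, VertexFamily₂ (W j) Lc C₂ δ₂) (hWinf : VertexFamily₂ Winf Lc C₂ δ₂)
    (hWrate : ∀ j, VertexFamily₂ (W j - Winf) Lc (c₂ * θ ^ j) δ₂)
    (hR : 0 < R) (hRK : R < δK) (hRS : R / 2 < δS) (hRW : R < δ₂) (hθ0 : 0 ≤ θ) (hθ1 : θ < 1) {μ ν : Fin 4} {N : ℝ}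
    (hident : secondMoment (hessKer (axDressK Lc Kinf) (axVertexOfK Kinf Lc Sinf) Winf) μ ν = B12Normalization.stepBal N Lc)
    (S : B12Beta.OneLoopSplit β)
    (hβ : ∀ j, S.β0 j = secondMoment (TbalOf Lc (JsBalOf hLc cE cVH cΛ W Cw δw hδw hW) j) μ ν) {γ r : ℝ}
    (hrem : RemainderConst S γ r) :
    ∃ A : ℝ, BetaAvgAFH (B12Normalization.stepBal N Lc - r) (2 * A) γ β :=
  betaAvgAFH_of_D1Drift_JsBalOf hLc cE cVH cΛ W Cw δw hδw hW S hβ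
    (HessKerDressedLimit.d1Drift_JsBalOf_of_lim_eq hLc cE cVH cΛ W Cw δw hδw hW hK hKinf hKrate hS hSinf hSrate hW₂ hWinf
      hWrate hR hRK hRS hRW hθ0 hθ1 μ ν hident) hrem

/-- **THE WHOLE LOCATED [III] LIST OVER THE CLOSED TERM FROM (CONV-C-Cauchy) + THE EXPLICIT IDENTIFICATION AT THE CONSTRUCTED LIMITS,
ALL PROFILES** — EXACTLY the six (CONV-C-Cauchy) data binders of §1's pointwise form (nothing added) + `0 ≤ θ < 1` + **`hident :
secondMoment (hessKer (axDressK Lc K∞) (axVertexOfK K∞ Lc S∞) W∞) μ ν = stepBal N Lc` at `K∞ := limMKerOf (KInvStep Lc)`,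
`S∞ := limStOf (j ↦ (JsBal0Of … j).S)`, `W∞ := limTabOf W`** (asym1's `HessKerDressedLimit.d1Drift_JsBalOf_of_cauchy_eq` produces the wall
`hD`; by `HessKerDressedLimit.secondMoment_limKernelOf_TbalOf_JsBalOf` this `hident` and §1's `hident` on `limKernelOf` are ONE statement),
then `AveragedAFCarrierJsBal` §1 ⟹ the conclusion of `wallEND_of_allScales_lim_eq_JsBalOf_cont_allProfiles`.  Discharges nothing of
`BetaPertH`. [cite: Balaban1987RG1, Thm 2 p.259 and Thm 3 p.264] [cite: Balaban1988Convergent, (2.5)–(2.9) pp.255–256, (2.28) p.259, (2.46) p.263] -/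
theorem wallEND_of_cauchy_eq_JsBalOf_cont_allProfiles
    (hK : ∀ j, Decays (KInvStep (d := 3) Lc j) C δK)
    (hKall : ∀ k j, Decays (KInvStep (d := 3) Lc (k + j) - KInvStep (d := 3) Lc k) (cK * θ ^ k) δK)
    (hS : ∀ j, LocStencil (JsBal0Of hLc cE cVH cΛ W Cw δw hδw hW j).S Cs δS)
    (hSall : ∀ k j, LocStencil ((JsBal0Of hLc cE cVH cΛ W Cw δw hδw hW (k + j)).S
      - (JsBal0Of hLc cE cVH cΛ W Cw δw hδw hW k).S) (cS * θ ^ k) δS)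
    (hW₂ : ∀ j, VertexFamily₂ (W j) Lc C₂ δ₂) (hW₂all : ∀ k j, VertexFamily₂ (W (k + j) - W k) Lc (c₂ * θ ^ k) δ₂)
    (hR : 0 < R) (hRK : R < δK) (hRS : R / 2 < δS) (hRW : R < δ₂) (hθ0 : 0 ≤ θ) (hθ1 : θ < 1) {μ ν : Fin 4} {N : ℝ}
    (hident : secondMoment (hessKer (axDressK Lc (limMKerOf (KInvStep (d := 3) Lc)))
        (axVertexOfK (limMKerOf (KInvStep (d := 3) Lc)) Lc (limStOf fun j => (JsBal0Of hLc cE cVH cΛ W Cw δw hδw hW j).S))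
        (limTabOf W)) μ ν = B12Normalization.stepBal N Lc)
    {Cn : B12.Construction} (hgen : ForwardGenerated Cn β) (hhalt : HaltsOutside Cn β) (hcur : CurriesHBeta Cn β)
    (S : B12Beta.OneLoopSplit β)
    (hβ : ∀ j, S.β0 j = secondMoment (TbalOf Lc (JsBalOf hLc cE cVH cΛ W Cw δw hδw hW) j) μ ν) {γ₀ r β₀ : ℝ}
    (hγ₀ : 0 < γ₀) (hrem : RemainderConst S γ₀ r) (hr : r < B12Normalization.stepBal N Lc) (hcont : BetaContH γ₀ β)
    (hβ₀ : 0 < β₀) {L : ℕ} (hL2 : 2 ≤ L) (p : ℕ) {κ₀ : ℕ} (hκ : 6 ≤ κ₀) :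
    EndpointExistence Cn ∧ ∃ A : ℝ, ∃ γ₁ : ℝ, 0 < γ₁ ∧
      ∀ γ : ℝ, 0 < γ → γ ≤ min γ₀ γ₁ → ∀ Pr : B12.RunParams, (Cn Pr).flow.InInterval γ Pr.K →
        ∀ p' : ℕ, p' ≤ p → ∀ A₀ : ℝ, 0 ≤ A₀ →
          ∃ Rj : ℕ → ℕ, (∀ j, B14.IsRj L p' ((Cn Pr).flow.g j) (Rj j)) ∧
            HorizonFacts (Cn Pr).flow (B12Normalization.stepBal N Lc + 2 * A + r) β₀ A₀ L p' κ₀ Rj Pr.K :=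
  wallEND_of_D1Drift_JsBalOf_cont_allProfiles hLc cE cVH cΛ W Cw δw hδw hW hgen hhalt hcur S hβ
    (HessKerDressedLimit.d1Drift_JsBalOf_of_cauchy_eq hLc cE cVH cΛ W Cw δw hδw hW hK hKall hS hSall hW₂ hW₂all hR hRK hRS hRW
      hθ0 hθ1 μ ν hident) hγ₀ hrem hr hcont hβ₀ hL2 p hκ

/-- **THE MINIMAL [III] CARRIER FROM (CONV-C-Cauchy) + THE EXPLICIT IDENTIFICATION AT THE CONSTRUCTED LIMITS**: the six data binders +
`0 ≤ θ < 1` + `hident` at `(limMKerOf (KInvStep Lc), limStOf (j ↦ (JsBal0Of … j).S), limTabOf W)` + `hβ` + (D4) ⟹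
`∃ A, BetaAvgAFH (stepBal N Lc − r) (2A) γ β` — `AveragedAFCarrierJsBal.betaAvgAFH_of_D1Drift_JsBalOf` ∘ asym1's
`HessKerDressedLimit.d1Drift_JsBalOf_of_cauchy_eq`. [folklore] -/
theorem betaAvgAFH_of_cauchy_eq_JsBalOf
    (hK : ∀ j, Decays (KInvStep (d := 3) Lc j) C δK)
    (hKall : ∀ k j, Decays (KInvStep (d := 3) Lc (k + j) - KInvStep (d := 3) Lc k) (cK * θ ^ k) δK)
    (hS : ∀ j, LocStencil (JsBal0Of hLc cE cVH cΛ W Cw δw hδw hW j).S Cs δS)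
    (hSall : ∀ k j, LocStencil ((JsBal0Of hLc cE cVH cΛ W Cw δw hδw hW (k + j)).S
      - (JsBal0Of hLc cE cVH cΛ W Cw δw hδw hW k).S) (cS * θ ^ k) δS)
    (hW₂ : ∀ j, VertexFamily₂ (W j) Lc C₂ δ₂) (hW₂all : ∀ k j, VertexFamily₂ (W (k + j) - W k) Lc (c₂ * θ ^ k) δ₂)
    (hR : 0 < R) (hRK : R < δK) (hRS : R / 2 < δS) (hRW : R < δ₂) (hθ0 : 0 ≤ θ) (hθ1 : θ < 1) {μ ν : Fin 4} {N : ℝ}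
    (hident : secondMoment (hessKer (axDressK Lc (limMKerOf (KInvStep (d := 3) Lc)))
        (axVertexOfK (limMKerOf (KInvStep (d := 3) Lc)) Lc (limStOf fun j => (JsBal0Of hLc cE cVH cΛ W Cw δw hδw hW j).S))
        (limTabOf W)) μ ν = B12Normalization.stepBal N Lc)
    (S : B12Beta.OneLoopSplit β)
    (hβ : ∀ j, S.β0 j = secondMoment (TbalOf Lc (JsBalOf hLc cE cVH cΛ W Cw δw hδw hW) j) μ ν) {γ r : ℝ}
    (hrem : RemainderConst S γ r) :
    ∃ A : ℝ, BetaAvgAFH (B12Normalization.stepBal N Lc - r) (2 * A) γ β :=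
  betaAvgAFH_of_D1Drift_JsBalOf hLc cE cVH cΛ W Cw δw hδw hW S hβ
    (HessKerDressedLimit.d1Drift_JsBalOf_of_cauchy_eq hLc cE cVH cΛ W Cw δw hδw hW hK hKall hS hSall hW₂ hW₂all hR hRK hRS hRW
      hθ0 hθ1 μ ν hident) hrem

end LimitCurrency

end Literature.MathematicalPhysics.QuantumFieldTheory.Balaban1983to89.Beta.AveragedAFCarrierJsBalCauchy

end
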